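import Literature.AlgebraicGeometry.Resolution.ZariskiProjectiveBundle
import Literature.AlgebraicGeometry.Resolution.BlowupSmoothProjective
import Literature.AlgebraicGeometry.Resolution.BaseChangeOverOpens
import Literature.AlgebraicGeometry.Resolution.KollarOrderReduction
import Literature.AlgebraicGeometry.Motives.VarietiesDimensionProofs
import Literature.AlgebraicGeometry.Motives.VarietiesRegularProofs
import Literature.AlgebraicGeometry.Motives.VarietiesProjectiveSpaceProofs
import HarnessLib

/-!
# The exceptional divisor of the blowing up of a smooth projective variety along a smooth closed
# subvariety is a smooth projective variety of dimension `dim Z + r` (Hartshorne II 8.24 (b))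

Topic `Literature/AlgebraicGeometry/Resolution`. PROVED over the tree, no named fact.

Let `i : Z ⟶ V` be a closed `ℂ`-immersion of smooth projective complex varieties of dimensions
`m` and `m + r + 1`, and let `β : B ⟶ V` be any blowing up of `V` along `ker i` (`IsBlowup`). The
exceptional divisor is `E = B ×_V Z` with its projection `q = pr₂ : E → Z`; as a `ℂ`-scheme its
structure morphism is `q ≫ (Z → Spec ℂ)`. By the tree's THEOREM
`Resolution.Hartshorne1977_exceptionalDivisor_locallyTrivial_holds` (Hartshorne II Thm. 8.24 (b) with
II Thm. 8.17: `q` is, Zariski-locally over `Z`, isomorphic over `Z` to `U × ℙʳ → U`;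
`Resolution.isZariskiProjectiveBundle_exceptionalDivisor`), `E` is a smooth projective variety of
dimension `m + r`:

* smooth of relative dimension `m + r` over `ℂ`: `q` is smooth of relative dimension `r`, because
  this property is Zariski-local on the target and over a trivialising `U` the restriction `q ∣_ U`
  is an isomorphism followed by the projection `U ⊗ ℙʳ → U`, a base change of the structure
  morphism of `ℙʳ_ℂ`, which is smooth of relative dimension `r`; then compose with `Z → Spec ℂ`
  (smooth of relative dimension `m`);
* projective: `pr₁ : E → B` is a closed immersion (base change of `i`) and `B` is projective
  (`IsBlowup.isSmoothProjective`: the centre `V(ker i) ≅ Z` is regular and `ker i ≠ ⊥` because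
  `dim Z = m ≠ m + r + 1 = dim V` forbids `i` from being surjective);
* geometrically irreducible: `q` is geometrically irreducible (again Zariski-local on the target,
  and `U ⊗ ℙʳ → U` is a base change of the geometrically irreducible `ℙʳ_ℂ → Spec ℂ`) and smooth,
  hence universally open; `Z → Spec ℂ` is geometrically irreducible and universally open; and
  geometric irreducibility is stable under such compositions (Mathlib
  `GeometricallyIrreducible.comp`).

More generally every Zariski `ℙʳ`-bundle `q : E ⟶ X` (`Resolution.IsZariskiProjectiveBundle`) over a
smooth projective `n`-fold `X` whose total space is projective over `ℂ` is a smooth projective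
`(n + r)`-fold (`IsZariskiProjectiveBundle.isSmoothProjective_of_isProjectiveOver`).

Provenance: this is the Literature home of the argument first landed Summits-side for route
`BoundaryReadout` (crux `PullbackAlgebraic`, stub `stub_exceptionalDivisorSmoothProjective`, file
`Summits/HodgeConjecture/HodgeConjecture/Theorems/BoundaryReadoutPullbackAlgebraicExceptionalDivisorSmoothProjective.lean`,
prover seats of that route), there GRANTED the local-triviality fact which is now a theorem; the
statements here are fact-free and importable from `Literature/`.

## References

* [Hartshorne1977] R. Hartshorne, Algebraic Geometry, GTM 52 (1977), II Thm. 8.24 (b), II Thm. 8.17,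
  III Prop. 10.1.
* [Fulton1998] W. Fulton, Intersection Theory, 2nd ed. (1998), App. B.6.9.
* [StacksProject] The Stacks Project, Tags 01V4 (smooth morphisms: local on the target, stable
  under base change and composition), 0366 (geometrically irreducible schemes).
-/

noncomputable section

open CategoryTheory CategoryTheory.Limits AlgebraicGeometry MonoidalCategory CartesianMonoidalCategory
open Literature.AlgebraicGeometry.Motives

namespace Literature.AlgebraicGeometry.Resolution

namespace IsZariskiProjectiveBundle

/-- **A property of morphisms which is Zariski-local on the target and holds for the projections
`U ⊗ ℙʳ_ℂ → U` holds for (the underlying morphism of) every Zariski `ℙʳ`-bundle.** Over a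
trivialising `U`, `q ∣_ U` is the trivialising isomorphism followed by the projection, so
`P (q ∣_ U)`; conclude by locality. [cite: StacksProject, Tag 01V4 (properties local on the target)] -/
theorem of_isZariskiLocalAtTarget {P : MorphismProperty Scheme.{0}} [IsZariskiLocalAtTarget P] {r : ℕ}
    {X E : SchemeOver ℂ} {q : E ⟶ X} (htriv : IsZariskiProjectiveBundle r q)
    (hP : ∀ U : X.left.Opens,
      P (fst (Over.mk (U.ι ≫ X.hom) : SchemeOver ℂ) (projectiveSpace r ℂ)).left) :
    P q.left := by
  refine IsZariskiLocalAtTarget.of_forall_exists_morphismRestrict (P := P) fun x ↦ ?_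
  obtain ⟨U, hxU, ψ, hψ⟩ := htriv x
  refine ⟨U, hxU, ?_⟩
  -- `ψ ≫ pr_U` satisfies `P`: `ψ` is an isomorphism and `pr_U` satisfies `P`
  have hP' : P (ψ.hom.left ≫
      (fst (Over.mk (U.ι ≫ X.hom) : SchemeOver ℂ) (projectiveSpace r ℂ)).left) :=
    (P.cancel_left_of_respectsIso _ _).2 (hP U)
  -- and it is `q ∣_ U`, both having the same composite with the monomorphism `U.ι`
  have hψ' : q.left ∣_ U ≫ U.ι =
      (ψ.hom.left ≫ (fst (Over.mk (U.ι ≫ X.hom) : SchemeOver ℂ) (projectiveSpace r ℂ)).left :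
        (q.left ⁻¹ᵁ U : Scheme) ⟶ (U : Scheme)) ≫ U.ι := by
    simp only [Category.assoc, morphismRestrict_ι]
    exact hψ.symm
  rw [(cancel_mono U.ι).mp hψ']
  exact hP'

/-- The projection `U ⊗ ℙʳ_ℂ → U` is smooth of relative dimension `r`: a base change of the
structure morphism `ℙʳ_ℂ → Spec ℂ`. [cite: Hartshorne1977, III Prop. 10.1] -/
theorem smoothOfRelativeDimension_fst_projectiveSpace (r : ℕ) (W : SchemeOver ℂ) :
    SmoothOfRelativeDimension r (fst W (projectiveSpace r ℂ)).left := by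
  change SmoothOfRelativeDimension r (pullback.fst W.hom (projectiveSpace r ℂ).hom)
  haveI := smoothOfRelativeDimension_isStableUnderBaseChange r
  exact MorphismProperty.pullback_fst _ _
    (isSmoothProjective_projectiveSpace_holds ℂ r).smoothOfRelativeDimension

/-- The projection `U ⊗ ℙʳ_ℂ → U` is geometrically irreducible: a base change of the
geometrically irreducible `ℙʳ_ℂ → Spec ℂ`. [cite: StacksProject, Tag 0366] -/
theorem geometricallyIrreducible_fst_projectiveSpace (r : ℕ) (W : SchemeOver ℂ) :
    GeometricallyIrreducible (fst W (projectiveSpace r ℂ)).left := by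
  change GeometricallyIrreducible (pullback.fst W.hom (projectiveSpace r ℂ).hom)
  haveI := (isSmoothProjective_projectiveSpace_holds ℂ r).geometricallyIrreducible
  infer_instance

/-- A Zariski `ℙʳ`-bundle is smooth of relative dimension `r`. [cite: Hartshorne1977, III Prop. 10.1] -/
theorem smoothOfRelativeDimension {r : ℕ} {X E : SchemeOver ℂ} {q : E ⟶ X}
    (htriv : IsZariskiProjectiveBundle r q) : SmoothOfRelativeDimension r q.left :=
  of_isZariskiLocalAtTarget (P := @SmoothOfRelativeDimension r) htriv
    fun _ ↦ smoothOfRelativeDimension_fst_projectiveSpace r _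

/-- A Zariski `ℙʳ`-bundle is geometrically irreducible (as a morphism). [cite: StacksProject, Tag 0366] -/
theorem geometricallyIrreducible {r : ℕ} {X E : SchemeOver ℂ} {q : E ⟶ X}
    (htriv : IsZariskiProjectiveBundle r q) : GeometricallyIrreducible q.left :=
  haveI : IsZariskiLocalAtTarget @GeometricallyIrreducible :=
    GeometricallyIrreducible.eq_geometrically ▸ inferInstance
  of_isZariskiLocalAtTarget (P := @GeometricallyIrreducible) htriv
    fun _ ↦ geometricallyIrreducible_fst_projectiveSpace r _

/-- A smooth morphism which is geometrically irreducible, composed with the structure morphism of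
a smooth geometrically irreducible `k`-scheme, is geometrically irreducible (smooth morphisms are
universally open; Mathlib `GeometricallyIrreducible.comp`). [cite: StacksProject, Tag 0366 and Tag 038K] -/
theorem geometricallyIrreducible_comp_of_smooth {n r : ℕ} {X : SchemeOver ℂ} {E : Scheme.{0}}
    (q : E ⟶ X.left) [SmoothOfRelativeDimension r q] [GeometricallyIrreducible q]
    (hX : IsSmoothProjective n X) : GeometricallyIrreducible (q ≫ X.hom) := by
  haveI := hX.smoothOfRelativeDimension
  haveI := hX.geometricallyIrreducible
  haveI : Smooth X.hom := SmoothOfRelativeDimension.smooth n X.hom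
  haveI : Smooth q := SmoothOfRelativeDimension.smooth r q
  exact GeometricallyIrreducible.comp q X.hom

/-- **A Zariski `ℙʳ`-bundle over a smooth projective `n`-fold with projective total space is a
smooth projective `(n + r)`-fold**: smooth of relative dimension `r + n` over `ℂ` (composition),
geometrically irreducible (`geometricallyIrreducible_comp_of_smooth`), projective by hypothesis.
[cite: Hartshorne1977, III Prop. 10.1] [cite: StacksProject, Tags 01V4 and 0366] -/
theorem isSmoothProjective_of_isProjectiveOver {n r : ℕ} {X E : SchemeOver ℂ} {q : E ⟶ X}
    (htriv : IsZariskiProjectiveBundle r q) (hX : IsSmoothProjective n X)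
    (hE : IsProjectiveOver E) : IsSmoothProjective (n + r) E := by
  haveI hq : SmoothOfRelativeDimension r q.left := htriv.smoothOfRelativeDimension
  haveI := hX.smoothOfRelativeDimension
  have hsm : SmoothOfRelativeDimension (n + r) E.hom := by
    rw [← Over.w q, Nat.add_comm]
    infer_instance
  haveI : GeometricallyIrreducible q.left := htriv.geometricallyIrreducible
  have hgi : GeometricallyIrreducible E.hom := by
    rw [← Over.w q]
    exact geometricallyIrreducible_comp_of_smooth (r := r) q.left hX
  exact ⟨hsm, hE, hgi⟩

end IsZariskiProjectiveBundle

/-- A smooth projective complex variety is a regular scheme. [cite: Hartshorne1977, II Thm. 8.24 (a) and III Thm. 10.2] -/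
theorem isRegular_of_isSmoothProjective' {n : ℕ} {X : SchemeOver ℂ} (hX : IsSmoothProjective n X) :
    Scheme.IsRegular X.left := by
  haveI := hX.smoothOfRelativeDimension
  exact fun x ↦ isRegularLocalRing_stalk_of_smoothOfRelativeDimension (f := X.hom) (n := n) x

/-- A closed immersion between smooth projective varieties of different dimensions is not
surjective (else it would be a homeomorphism, and the dimension of a smooth projective variety of
relative dimension `n` is `n`). [cite: Hartshorne1977, II Ex. 3.20 and III.10] -/
theorem range_ne_univ_of_isSmoothProjective_of_ne {m n : ℕ} {Z V : SchemeOver ℂ} (i : Z ⟶ V)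
    [IsClosedImmersion i.left] (hZ : IsSmoothProjective m Z) (hV : IsSmoothProjective n V)
    (hmn : m ≠ n) : Set.range i.left ≠ Set.univ := by
  intro huniv
  have hf : IsHomeomorph i.left.base :=
    (isHomeomorph_iff_isEmbedding_surjective (f := i.left.base)).2
      ⟨i.left.isClosedEmbedding.isEmbedding, Set.range_eq_univ.1 huniv⟩
  have h₁ := schemeDim_eq_holds hZ
  have h₂ := schemeDim_eq_holds hV
  unfold schemeDim at h₁ h₂
  rw [hf.topologicalKrullDim_eq] at h₁
  exact hmn (h₁.symm.trans h₂)

/-- **The blowing up of a smooth projective `n`-fold along a smooth closed subvariety of smaller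
dimension `m` is a smooth projective `n`-fold** (the tree's `IsBlowup.isSmoothProjective`, with its
two side conditions discharged: `ker i ≠ ⊥` since `i` is not onto, and `V(ker i) ≅ Z` regular).
[cite: Hartshorne1977, II Prop. 7.16 and II Thm. 8.24] -/
theorem IsBlowup.isSmoothProjective_of_closedImmersion {m n : ℕ} {V Z B : SchemeOver ℂ} (i : Z ⟶ V)
    (β : B ⟶ V) (hV : IsSmoothProjective n V) (hZ : IsSmoothProjective m Z)
    [IsClosedImmersion i.left] (hβ : IsBlowup β.left i.left.ker) (hmn : m ≠ n) :
    IsSmoothProjective n (Over.mk (β.left ≫ V.hom) : SchemeOver ℂ) :=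
  hβ.isSmoothProjective hV
    (ker_ne_bot_of_range_ne_univ i.left (range_ne_univ_of_isSmoothProjective_of_ne i hZ hV hmn))
    (isRegular_ker_subscheme i.left (isRegular_of_isSmoothProjective' hZ))

/-- **The exceptional divisor of the blowing up of a smooth projective variety along a smooth
closed subvariety is a smooth projective variety of dimension `dim Z + r`** (Hartshorne II 8.24 (b);
Fulton 1998 B.6.9): for `i : Z ⟶ V` a closed immersion of smooth projective complex varieties of
dimensions `m`, `m + r + 1` and any blowing up `β : B ⟶ V` along `ker i`, the `ℂ`-scheme
`E = B ×_V Z` (structure map through `pr₂` and `Z`) is smooth projective of dimension `m + r`: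
smooth of relative dimension `r` over `Z` (locally `U × ℙʳ`,
`isZariskiProjectiveBundle_exceptionalDivisor`), hence of relative dimension `m + r` over `ℂ`;
projective as a closed subscheme (`pr₁`, base change of the closed immersion `i`) of `B`, which is
projective (`IsBlowup.isSmoothProjective_of_closedImmersion`); geometrically irreducible because
`pr₂` is geometrically irreducible and smooth over the geometrically irreducible `Z`.
[cite: Hartshorne1977, II Thm. 8.24 (b)] [cite: Fulton1998, App. B.6.9] -/
theorem isSmoothProjective_exceptionalDivisor {m r : ℕ} {V Z B : SchemeOver ℂ} (i : Z ⟶ V) (β : B ⟶ V)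
    (hV : IsSmoothProjective (m + r + 1) V) (hZ : IsSmoothProjective m Z)
    (hi : IsClosedImmersion i.left) (hβ : IsBlowup β.left i.left.ker) :
    IsSmoothProjective (m + r) (Over.mk (pullback.snd β.left i.left ≫ Z.hom) : SchemeOver ℂ) := by
  haveI := hi
  have htriv := isZariskiProjectiveBundle_exceptionalDivisor (k := ℂ) (r := r) i β hV hZ hi hβ
  -- projective: `pr₁ : E → B` is a closed immersion into the projective blow-up `B`
  have hB : IsSmoothProjective (m + r + 1) (Over.mk (β.left ≫ V.hom) : SchemeOver ℂ) :=
    IsBlowup.isSmoothProjective_of_closedImmersion i β hV hZ hβ (by omega)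
  let k : (Over.mk (pullback.snd β.left i.left ≫ Z.hom) : SchemeOver ℂ) ⟶
      (Over.mk (β.left ≫ V.hom) : SchemeOver ℂ) :=
    Over.homMk (pullback.fst β.left i.left) (by
      change pullback.fst β.left i.left ≫ β.left ≫ V.hom = pullback.snd β.left i.left ≫ Z.hom
      rw [pullback.condition_assoc, Over.w i])
  haveI : IsClosedImmersion k.left :=
    inferInstanceAs (IsClosedImmersion (pullback.fst β.left i.left))
  have hproj : IsProjectiveOver (Over.mk (pullback.snd β.left i.left ≫ Z.hom) : SchemeOver ℂ) :=
    isProjectiveOver_of_isClosedImmersion_left k hB.isProjectiveOver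
  exact htriv.isSmoothProjective_of_isProjectiveOver hZ hproj

end Literature.AlgebraicGeometry.Resolution

end
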